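import Summits.BirchSwinnertonDyer.Rank1Residual.F1Sign2.KuriharaStructureAtTwo
import HarnessLib

/-!
# Kurihara level sums at two — carriers and the pairing lemma (cell bsd-f1-sign2, seat -es, MEMO-es §10–§11)

New carriers over the tree's `F1Sign2.KuriharaStructureAtTwo` (`kuriharaSumTwo`, `IsLevelAtTwo`,
`PeriodTransferAtTwo` are imported, not re-declared): the level-`k` single-prime Kurihara number at two in the
integral normalisation `levelSumTwo f ℓ k ψ = δ'_k(ℓ; ψ) = ∑_{u ∈ (ℤ/ℓ)ˣ} 2[u/ℓ]⁺_f ψ(u)` (`ψ : (ℤ/ℓ)ˣ → ℤ/2^k`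
lifted to `{0,…,2^k−1}`; canonical modulo `2^k`), the pair number `pairLevelSumTwo`, and the predicate
`InTwoPowZLoc k x` ("`x ∈ 2^k ℤ_{(2)}`").  Then the PAIRING LEMMA `levelSum_inTwoPowZLoc`: if `u ↦ u*` is an
involution of `(ℤ/ℓ)ˣ` preserving the symbol `Λ` and shifting `ψ` by an ODD constant (`ψ(u*) = c − ψ(u)`,
`c` odd), then `∑_u Λ(u) ψ(u) ∈ 2^k ℤ_{(2)}` as soon as `∑_u Λ(u) ∈ 2^{k+1} ℤ_{(2)}`-compatible data hold —
the kernel of K2-V (`F1Sign2.KuriharaLevelVanishingAtTwo[Proofs]`).  Elementary (finite sums, `ZMod`).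

TYPER FILING (seat `bsd-f1-sign2-ty`, -es landing kit part 1/4, INBOX 2026-08-27T18:53:21Z): `HOME/data-es/landing/KuriharaLevelSumsAtTwo.lean`
sha16 0336cb9964787e90 (generated by `split.py` from `SketchG6.lean` d35efc04968d755c; joint farm check `Joint.lean` d1eaf26b918c249a rc 0, 0 warnings,
0 sorries, standard axioms), re-filed VERBATIM. REF1-AUDIT §19 verdicts (prop33_tau_ratR FAITHFUL-ASSEMBLY = §14 C′; K2-F
`FirstLayerLawAtTwo` SURVIVES crux-grade OPEN; K2-F_an support) TRANSFER to this kit decl-for-decl (REF1 g3 INBOX 19:02:06Z, 31/31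
bodies equal); K2-V/K2-P: REF1 §14 (G3 text; the G6 `LevelVanishingAtTwo` is the finer (W, ℓ, k, ψ) text whose conductor-level
case is PROVED unconditionally in part 3). REF2 v8/v9: K2-V IN-PRINT-ASSEMBLY support, K2-F OPEN-IN-PRINT (Kim 2022 p ≥ 5
template; beyond-print if proved: YES). Nothing asserted beyond the kernel-checked theorems; no named fact; PARTITION: none moved. -/

set_option autoImplicit false

noncomputable section

open scoped Classical MatrixGroups ModularForm

open CongruenceSubgroup WeierstrassCurve Literature.NumberTheory.EllipticCurves
  Literature.NumberTheory.EllipticCurves.ModularForms NumberField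

namespace Summit.BirchSwinnertonDyer.Rank1Residual.F1Sign2

/-! ## §1 New carriers: level sums and the `2^k ℤ_{(2)}` predicate (the tree's `kuriharaSumTwo`, `IsLevelAtTwo`, `PeriodTransferAtTwo` are imported from `F1Sign2.KuriharaStructureAtTwo`) -/

section Rational

variable {N : ℕ} (f : CuspForm (Gamma0 N) 2)

/-- **The level-`k` single-prime Kurihara number at two (integral normalisation)**
`δ'_k(ℓ; ψ) = ∑_{u ∈ (ℤ/ℓ)ˣ} 2[u/ℓ]⁺_f · ψ(u)` with `ψ(u) ∈ ℤ/2^k` lifted to `{0, …, 2^k − 1}`. -/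
def levelSumTwo (ℓ k : ℕ) [NeZero ℓ] (ψ : (ZMod ℓ)ˣ →* Multiplicative (ZMod (2 ^ k))) : ℚ :=
  ∑ u : (ZMod ℓ)ˣ, 2 * ratPlusSymbol f ((((u : ZMod ℓ).val : ℚ)) / ℓ) *
    (((Multiplicative.toAdd (ψ u)).val : ℕ) : ℚ)

/-- **The level-2 pair Kurihara number at two (integral normalisation)**
`δ'_2(n; ψ₁, ψ₂) = ∑_{u ∈ (ℤ/n)ˣ} 2[u/n]⁺_f · ψ₁(u mod ℓ₁) · ψ₂(u mod ℓ₂)`, `n = ℓ₁ℓ₂`. -/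
def pairLevelSumTwo (ℓ₁ ℓ₂ : ℕ) [NeZero (ℓ₁ * ℓ₂)]
    (ψ₁ : (ZMod ℓ₁)ˣ →* Multiplicative (ZMod 4)) (ψ₂ : (ZMod ℓ₂)ˣ →* Multiplicative (ZMod 4)) : ℚ :=
  ∑ u : (ZMod (ℓ₁ * ℓ₂))ˣ, 2 * ratPlusSymbol f ((((u : ZMod (ℓ₁ * ℓ₂)).val : ℚ)) / (ℓ₁ * ℓ₂)) *
    (((Multiplicative.toAdd (ψ₁ (ZMod.unitsMap (dvd_mul_right ℓ₁ ℓ₂) u))).val : ℕ) : ℚ) *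
    (((Multiplicative.toAdd (ψ₂ (ZMod.unitsMap (dvd_mul_left ℓ₂ ℓ₁) u))).val : ℕ) : ℚ)

/-- "`x ∈ 2^k ℤ_{(2)}`": `x = 2^k q` with `q` of odd denominator. -/
def InTwoPowZLoc (k : ℕ) (x : ℚ) : Prop := ∃ q : ℚ, x = 2 ^ k * q ∧ Odd q.den

end Rational

/-! ## The pairing lemma (core of K2-V): a fixed-point-free involution on `ψ`-buckets -/

section Pairing

open Finset

/-- A sum of an integer-valued function invariant under a fixed-point-free involution is even. -/
theorem two_dvd_sum_of_involution_invariant {α : Type*} [DecidableEq α] (s : Finset α)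
    (σ : α → α) (hσs : ∀ a ∈ s, σ a ∈ s) (hinv : ∀ a ∈ s, σ (σ a) = a) (hfix : ∀ a ∈ s, σ a ≠ a)
    (g : α → ℤ) (hg : ∀ a ∈ s, g (σ a) = g a) : (2 : ℤ) ∣ ∑ a ∈ s, g a := by
  have h : (((∑ a ∈ s, g a : ℤ)) : ZMod 2) = 0 := by
    push_cast
    refine Finset.sum_involution (fun a _ => σ a) ?_ ?_ ?_ ?_
    · intro a ha
      rw [hg a ha]
      have h2 : ((g a : ZMod 2)) + (g a : ZMod 2) = 2 * (g a : ZMod 2) := by ring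
      rw [h2]
      have h0 : (2 : ZMod 2) = 0 := by decide
      rw [h0, zero_mul]
    · intro a ha _
      exact hfix a ha
    · intro a ha
      exact hσs a ha
    · intro a ha
      exact hinv a ha
  exact (ZMod.intCast_zmod_eq_zero_iff_dvd _ 2).mp h

/-- In `ℤ/2^k` with `k ≥ 1`, `c − j = j` is impossible when `c.val` is odd. -/
theorem sub_ne_self_of_odd_val {k : ℕ} (hk : 1 ≤ k) (c j : ZMod (2 ^ k)) (hc : Odd c.val) :
    c - j ≠ j := by
  haveI : NeZero (2 ^ k) := ⟨by positivity⟩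
  intro h
  have h2 : (2 : ZMod (2 ^ k)) * j = c := by linear_combination (-1 : ZMod (2 ^ k)) * h
  have hdvd : 2 ∣ 2 ^ k := dvd_pow_self 2 (by omega)
  have hc0 : (ZMod.castHom hdvd (ZMod 2)) c = 0 := by
    rw [← h2, map_mul, map_ofNat]
    have h0 : (2 : ZMod 2) = 0 := by decide
    rw [h0, zero_mul]
  rw [ZMod.castHom_apply, ZMod.cast_eq_val] at hc0
  have h2c : Even c.val := ZMod.natCast_eq_zero_iff_even.mp hc0
  exact (Nat.not_even_iff_odd.mpr hc) h2c

/-- **The pairing lemma** (K2-V core). -/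
theorem two_pow_dvd_sum_val_mul_of_reflect {k : ℕ} (hk : 1 ≤ k) (c : ZMod (2 ^ k))
    (hc : Odd c.val) (I : ZMod (2 ^ k) → ℤ) (hI : ∀ j, I (c - j) = I j)
    (hsum : (2 : ℤ) ^ (k + 1) ∣ ∑ j, I j) :
    (2 : ℤ) ^ k ∣ ∑ j, (j.val : ℤ) * I j := by
  haveI : NeZero (2 ^ k) := ⟨by positivity⟩
  -- (1) reindex by the reflection
  have hS' : ∑ j : ZMod (2 ^ k), (j.val : ℤ) * I j = ∑ j : ZMod (2 ^ k), ((c - j).val : ℤ) * I j := by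
    refine Fintype.sum_equiv (Equiv.subLeft c) _ _ ?_
    intro j
    simp only [Equiv.subLeft_apply]
    rw [sub_sub_cancel, hI]
  -- (2) the representative defect `d j = j.val + (c - j).val - c.val` is a multiple of `2^k`
  have hdiv : ∀ j : ZMod (2 ^ k), (2 ^ k : ℤ) ∣ ((j.val : ℤ) + (c - j).val - c.val) := by
    intro j
    have h0 : ((((j.val : ℤ) + (c - j).val - c.val : ℤ)) : ZMod (2 ^ k)) = 0 := by
      push_cast
      rw [ZMod.natCast_zmod_val, ZMod.natCast_zmod_val, ZMod.natCast_zmod_val]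
      ring
    have := (ZMod.intCast_zmod_eq_zero_iff_dvd _ (2 ^ k)).mp h0
    exact_mod_cast this
  set q : ZMod (2 ^ k) → ℤ := fun j => ((j.val : ℤ) + (c - j).val - c.val) / 2 ^ k with hq
  have hqd : ∀ j, (2 ^ k : ℤ) * q j = (j.val : ℤ) + (c - j).val - c.val := fun j =>
    Int.mul_ediv_cancel' (hdiv j)
  have hqsym : ∀ j, q (c - j) = q j := by
    intro j
    simp only [hq, sub_sub_cancel]
    ring_nf
  -- (3) the q-weighted sum is even (fixed-point-free involution)
  have heven : (2 : ℤ) ∣ ∑ j : ZMod (2 ^ k), q j * I j := by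
    refine two_dvd_sum_of_involution_invariant (Finset.univ) (fun j => c - j) (fun _ _ => mem_univ _)
      (fun j _ => sub_sub_cancel c j) (fun j _ => sub_ne_self_of_odd_val hk c j hc) _ ?_
    intro j _
    show q (c - j) * I (c - j) = q j * I j
    rw [hqsym, hI]
  -- (4) 2 S = c.val * ∑ I + 2^k * ∑ q I
  have h2S : 2 * ∑ j : ZMod (2 ^ k), (j.val : ℤ) * I j =
      (c.val : ℤ) * ∑ j, I j + 2 ^ k * ∑ j, q j * I j := by
    rw [two_mul]
    nth_rewrite 2 [hS']
    rw [← Finset.sum_add_distrib, Finset.mul_sum, Finset.mul_sum, ← Finset.sum_add_distrib]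
    refine Finset.sum_congr rfl ?_
    intro j _
    have := hqd j
    linear_combination (I j) * this.symm
    -- fallback handled below if linear_combination shape differs
  obtain ⟨A, hA⟩ := hsum
  obtain ⟨B, hB⟩ := heven
  have hfinal : 2 * ∑ j : ZMod (2 ^ k), (j.val : ℤ) * I j = 2 * (2 ^ k * ((c.val : ℤ) * A + B)) := by
    rw [h2S, hA, hB]
    ring
  have hcancel : ∑ j : ZMod (2 ^ k), (j.val : ℤ) * I j = 2 ^ k * ((c.val : ℤ) * A + B) :=
    mul_left_cancel₀ two_ne_zero hfinal
  exact ⟨_, hcancel⟩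

/-- **The pairing lemma over `ℚ` with odd denominators** (the form used by K2-V: the symbols
`2[u/ℓ]⁺` are `2`-integral rationals, not integers). -/
theorem inTwoPowZLoc_sum_val_mul_of_reflect {k : ℕ} (hk : 1 ≤ k) (c : ZMod (2 ^ k))
    (hc : Odd c.val) (I : ZMod (2 ^ k) → ℚ) (hI : ∀ j, I (c - j) = I j)
    (hint : ∀ j, Odd (I j).den) (hsum : InTwoPowZLoc (k + 1) (∑ j, I j)) :
    InTwoPowZLoc k (∑ j, (j.val : ℚ) * I j) := by
  haveI : NeZero (2 ^ k) := ⟨by positivity⟩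
  obtain ⟨q₀, hq₀, hq₀d⟩ := hsum
  -- a common odd denominator
  set D : ℕ := q₀.den * ∏ j : ZMod (2 ^ k), (I j).den with hD
  have hDodd : Odd D := by
    rw [hD]
    refine Nat.odd_mul.mpr ⟨hq₀d, ?_⟩
    exact Finset.prod_induction _ Odd (fun a b ha hb => Nat.odd_mul.mpr ⟨ha, hb⟩) odd_one
      (fun j _ => hint j)
  have hD0 : (D : ℚ) ≠ 0 := by
    have : D ≠ 0 := fun h => by simp [h] at hDodd
    exact_mod_cast this
  have hden_dvd : ∀ j, (I j).den ∣ D := fun j =>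
    Dvd.dvd.mul_left (Finset.dvd_prod_of_mem (fun i => (I i).den) (Finset.mem_univ j)) _
  have hq₀_dvd : q₀.den ∣ D := Dvd.intro _ rfl
  -- integrality of D * I j and D * q₀
  have hZ : ∀ j, ∃ z : ℤ, (D : ℚ) * I j = z := by
    intro j
    obtain ⟨e, he⟩ := hden_dvd j
    refine ⟨(e : ℤ) * (I j).num, ?_⟩
    rw [he]; push_cast
    rw [mul_comm ((I j).den : ℚ) (e : ℚ), mul_assoc, Rat.den_mul_eq_num]
  choose Z hZ using hZ
  have hz₀ : ∃ z₀ : ℤ, (D : ℚ) * q₀ = z₀ := by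
    obtain ⟨e, he⟩ := hq₀_dvd
    refine ⟨(e : ℤ) * q₀.num, ?_⟩
    rw [he]; push_cast
    rw [mul_comm (q₀.den : ℚ) (e : ℚ), mul_assoc, Rat.den_mul_eq_num]
  obtain ⟨z₀, hz₀⟩ := hz₀
  -- transfer the hypotheses to Z
  have hZI : ∀ j, Z (c - j) = Z j := by
    intro j
    have : (Z (c - j) : ℚ) = Z j := by rw [← hZ, ← hZ, hI]
    exact_mod_cast this
  have hZsum : (2 : ℤ) ^ (k + 1) ∣ ∑ j, Z j := by
    refine ⟨z₀, ?_⟩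
    have : ((∑ j, Z j : ℤ) : ℚ) = (2 : ℚ) ^ (k + 1) * z₀ := by
      push_cast
      rw [← hz₀, mul_left_comm, ← hq₀, Finset.mul_sum]
      exact Finset.sum_congr rfl (fun j _ => (hZ j).symm)
    exact_mod_cast this
  obtain ⟨w, hw⟩ := two_pow_dvd_sum_val_mul_of_reflect hk c hc Z hZI hZsum
  refine ⟨(w : ℚ) / D, ?_, ?_⟩
  · -- D * ∑ j.val I j = ∑ j.val Z j = 2^k w
    have key : (D : ℚ) * ∑ j : ZMod (2 ^ k), (j.val : ℚ) * I j = (2 : ℚ) ^ k * w := by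
      have : (((∑ j : ZMod (2 ^ k), (j.val : ℤ) * Z j : ℤ)) : ℚ) = ((2 : ℤ) ^ k * w : ℤ) := by
        rw [hw]
      push_cast at this
      rw [← this, Finset.mul_sum]
      refine Finset.sum_congr rfl (fun j _ => ?_)
      rw [← hZ j]; ring
    field_simp
    linear_combination key
  · -- the denominator of w / D divides the odd number D
    have h1 : (((w : ℚ) / D).den : ℤ) ∣ (D : ℤ) := by
      have := Rat.den_dvd w D
      have hcast : ((w : ℚ) / D) = Rat.divInt w D := by
        rw [← Rat.intCast_div_eq_divInt]; push_cast; rfl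
      rwa [hcast]
    have h2 : ((w : ℚ) / D).den ∣ D := by exact_mod_cast h1
    exact hDodd.of_dvd_nat h2

/-- Odd denominators are stable under addition. -/
theorem odd_den_add {x y : ℚ} (hx : Odd x.den) (hy : Odd y.den) : Odd (x + y).den :=
  (Nat.odd_mul.mpr ⟨hx, hy⟩).of_dvd_nat (Rat.add_den_dvd x y)

/-- **K2-V, abstract symbol form.** `Λ : (ℤ/ℓ)ˣ → ℚ` (think `Λ u = 2[u/ℓ]⁺_f`) with odd denominators,
invariant under `u ↦ (N̄u)⁻¹` (Fricke/Atkin–Lehner symmetry of plus symbols, `w(E) = +1`), with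
`∑ Λ ∈ 2^{k+1}ℤ_{(2)}` (Hecke: `∑_u 2[u/ℓ]⁺ = 2(a_ℓ − 2)[0]⁺`, `2^k ∣ a_ℓ − 2`, `[0]⁺ ∈ ℤ_{(2)}`), and a
discrete logarithm `ψ : (ℤ/ℓ)ˣ → ℤ/2^k` with `ψ(N̄⁻¹)` ODD (for `ψ` onto: `(N/ℓ) = −1`). Then the
level-`k` Kurihara functional `∑_u Λ(u) ψ(u)` (with `ψ(u)` lifted to `{0,…,2^k−1}`) lies in `2^kℤ_{(2)}`. -/
theorem levelSum_inTwoPowZLoc {ℓ : ℕ} [NeZero ℓ] {k : ℕ} (hk : 1 ≤ k) (Λ : (ZMod ℓ)ˣ → ℚ)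
    (ψ : (ZMod ℓ)ˣ →* Multiplicative (ZMod (2 ^ k))) (Nbar : (ZMod ℓ)ˣ)
    (hR : ∀ u, Λ (Nbar * u)⁻¹ = Λ u)
    (hodd : Odd (Multiplicative.toAdd (ψ Nbar⁻¹)).val)
    (hint : ∀ u, Odd (Λ u).den) (hsum : InTwoPowZLoc (k + 1) (∑ u, Λ u)) :
    InTwoPowZLoc k (∑ u, Λ u * (((Multiplicative.toAdd (ψ u)).val : ℕ) : ℚ)) := by
  haveI : NeZero (2 ^ k) := ⟨by positivity⟩
  set a : (ZMod ℓ)ˣ → ZMod (2 ^ k) := fun u => Multiplicative.toAdd (ψ u) with ha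
  set c : ZMod (2 ^ k) := a Nbar⁻¹ with hc
  set σ : (ZMod ℓ)ˣ → (ZMod ℓ)ˣ := fun u => (Nbar * u)⁻¹ with hσ
  have hσσ : ∀ u, σ (σ u) = u := by
    intro u
    simp only [hσ, mul_inv_rev, inv_inv]
    exact mul_inv_cancel_comm Nbar u
  have haσ : ∀ u, a (σ u) = c - a u := by
    intro u
    simp only [ha, hc, hσ, map_inv, map_mul, toAdd_inv, toAdd_mul]
    abel
  set I : ZMod (2 ^ k) → ℚ := fun j => ∑ u ∈ Finset.univ.filter (fun u => a u = j), Λ u with hI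
  -- (1) bucket decomposition of the functional
  have step1 : ∑ u, Λ u * (((a u).val : ℕ) : ℚ) = ∑ j, (j.val : ℚ) * I j := by
    rw [← Finset.sum_fiberwise Finset.univ a (fun u => Λ u * (((a u).val : ℕ) : ℚ))]
    refine Finset.sum_congr rfl (fun j _ => ?_)
    rw [hI]
    simp only
    rw [Finset.mul_sum]
    refine Finset.sum_congr rfl (fun u hu => ?_)
    rw [Finset.mem_filter] at hu
    rw [hu.2]; ring
  -- (2) reflection invariance of the buckets
  have step2 : ∀ j, I (c - j) = I j := by
    intro j
    rw [hI]
    simp only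
    symm
    refine Finset.sum_nbij' σ σ ?_ ?_ ?_ ?_ ?_
    · intro u hu
      simp only [Finset.mem_filter, Finset.mem_univ, true_and] at hu ⊢
      rw [haσ, hu]
    · intro v hv
      simp only [Finset.mem_filter, Finset.mem_univ, true_and] at hv ⊢
      rw [haσ, hv, sub_sub_cancel]
    · intro u _; exact hσσ u
    · intro v _; exact hσσ v
    · intro u _; exact (hR u).symm
  -- (3) odd denominators of the buckets, (4) total sum
  have step3 : ∀ j, Odd (I j).den := by
    intro j
    rw [hI]
    exact Finset.sum_induction _ (fun q : ℚ => Odd q.den) (fun x y hx hy => odd_den_add hx hy)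
      (by simp) (fun u _ => hint u)
  have step4 : ∑ j, I j = ∑ u, Λ u := by
    rw [hI]
    exact Finset.sum_fiberwise Finset.univ a Λ
  have hsum' : InTwoPowZLoc (k + 1) (∑ j, I j) := by rw [step4]; exact hsum
  have := inTwoPowZLoc_sum_val_mul_of_reflect hk c hodd I step2 step3 hsum'
  -- `a u` is `Multiplicative.toAdd (ψ u)` by definition
  show InTwoPowZLoc k (∑ u, Λ u * (((a u).val : ℕ) : ℚ))
  rw [step1]
  exact this

end Pairing

/-! ## Monotonicity -/

/-- `InTwoPowZLoc` is monotone downwards in the exponent (`2^k ℤ_{(2)} ⊆ 2^j ℤ_{(2)}` for `j ≤ k`). -/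
theorem inTwoPowZLoc_mono {j k : ℕ} (hjk : j ≤ k) {x : ℚ} (h : InTwoPowZLoc k x) : InTwoPowZLoc j x := by
  obtain ⟨q, hq, hqd⟩ := h
  refine ⟨2 ^ (k - j) * q, ?_, ?_⟩
  · rw [hq, ← mul_assoc, ← pow_add, Nat.add_sub_cancel' hjk]
  · have h1 : ((2 : ℚ) ^ (k - j) * q).den ∣ ((2 : ℚ) ^ (k - j)).den * q.den := Rat.mul_den_dvd _ _
    have h2 : ((2 : ℚ) ^ (k - j)).den = 1 := by
      have : ((2 : ℚ) ^ (k - j)) = ((2 ^ (k - j) : ℕ) : ℚ) := by push_cast; ring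
      rw [this]; exact Rat.den_natCast _
    rw [h2, one_mul] at h1
    exact hqd.of_dvd_nat h1

end Summit.BirchSwinnertonDyer.Rank1Residual.F1Sign2
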